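import Literature.AlgebraicGeometry.HodgeTheory.ZariskiClosureFiniteIndex
import HarnessLib

/-!
# `SL(V)` lies in the identity component of every algebraic group containing it, and in the closure of
# every subgroup containing the commutators of `GL(V)` — on `K`-points (Borel, *Linear Algebraic Groups*,
# I.2.2, I.2.3–2.4; Dieudonné / Mathlib: `SL` is generated by transvections and rank-one tori)

Family `hodge`, layer `Literature/AlgebraicGeometry/HodgeTheory`. THEOREMS in the vocabulary of the tree's
`K`-points Zariski closure `glZariskiClosure Γ` / identity component `glIdentityComponent Γ` of a subgroup
`Γ ≤ GL(V)` (`AlgebraicMonodromyMumfordTate`; closure = polynomials in the matrix entries). Written by the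
prover seat `hodge-nonav-prover-A` (cell `hodge-nonav`) for the crux K1 `VeryGeneralDeckCommutatorsInHg` of
`Summits/HodgeConjecture/HodgeConjecture/Theses/CyclicUnitaryPowers.lean` (`stmt-HodgeConjecture-19544`),
lane-D roadmap §2 (c): the per-eigenspace input "`SL(E_j)(ℂ) ⊆ glIdentityComponent Γ_j`" of the
Goursat–Kolchin–Ribet step (`Katz1990_goursatKolchinRibet_specialLinear`, hypothesis (1) in the consumable
form (1′)), from Carlson–Toledo's density ("`[U(h), U(h)] ⊆ Γ_j^Zar(ℂ)`",
`commutator_mem_glZariskiClosure_of_prime_order`) via `UnitaryGroupZariskiDense`.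

The two statements (both standard; `K` a field, `V` finite-dimensional):
* **`mem_glIdentityComponent_of_det_eq_one`** (`K` algebraically closed of characteristic `0`): if every
  determinant-one automorphism lies in `Γ^Zar(K)`, then every determinant-one automorphism lies in
  `(Γ^Zar)°(K)` — "`SL_n ⊆ G ⇒ SL_n ⊆ G°`", `SL_n` being connected (Borel I.2.2–2.3: `SL_n` is generated by
  the connected one-parameter groups of transvections and by tori). Points proof: `SL(V)` is generated by
  transvections `1 + a·E_{ij}` and rank-one tori `diag(…, c, …, c⁻¹, …)` (Mathlib
  `Matrix.SpecialLinearGroup.diagonal_transvection_induction'`), each of which has an `M`-th root OF THE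
  SAME KIND for every `M ≥ 1` (`a/M`; `c^{1/M}`), hence lies in `(Γ^Zar)°(K)` by
  `ZariskiClosureFiniteIndex.pow_factorial_index_mem_glZariskiClosure`.
* **`mem_glZariskiClosure_of_det_eq_one_of_commutators`** (`char K = 0`): if `g h g⁻¹ h⁻¹ ∈ Γ^Zar(K)` for
  all `g, h ∈ GL(V)`, then every determinant-one automorphism lies in `Γ^Zar(K)` — "`(GL_n, GL_n) = SL_n`"
  (Borel I.2.3–2.4 / Dieudonné): a transvection is the commutator of a diagonal matrix and a transvection,
  a rank-one torus element `diag(c, c⁻¹)` is the commutator of `diag(c, 1)` and the transposition matrix,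
  and `Γ^Zar(K)` is a group (`GlZariskiClosureGroup`).
No theory of algebraic groups is used; `dim V ≤ 1` (where `SL(V) = 1`) is included.

## References
* [Borel1991] A. Borel, *Linear Algebraic Groups*, 2nd ed., GTM 126 (1991): I.2.2 (groups generated by
  connected subvarieties are connected; one-parameter groups), I.2.3 (commutator groups), I.2.4.
* [CarlsonMullerStachPeters2017] J. Carlson, S. Müller-Stach, C. Peters, *Period Mappings and Period
  Domains*, 2nd ed. (2017), Lemma–Definition 15.3.7 (the vocabulary `Γ^Zar`, `Mon = (Γ^Zar)°`).
-/

noncomputable section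

open Literature.AlgebraicGeometry.Motives

namespace Literature.AlgebraicGeometry.HodgeTheory

universe u v

variable {K : Type u} [Field K] {V : Type v} [AddCommGroup V] [Module K V]

/-! ### §1 Automorphisms with a prescribed invertible matrix; matrix identities -/

section Matrices

variable {ι : Type*} [Fintype ι] [DecidableEq ι]

/-- Every matrix with unit determinant is the matrix of an automorphism (`Matrix.toLinearEquiv`).
[folklore] -/
private theorem exists_linearEquiv_toMatrix_eq (b : Module.Basis ι K V) (N : Matrix ι ι K) (hN : IsUnit N.det) :
    ∃ g : V ≃ₗ[K] V, LinearMap.toMatrix b b (g : Module.End K V) = N := by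
  refine ⟨Matrix.toLinearEquiv b N hN, ?_⟩
  have h : ((Matrix.toLinearEquiv b N hN : V ≃ₗ[K] V) : Module.End K V) = Matrix.toLin b b N :=
    LinearMap.ext fun x => Matrix.toLinearEquiv_apply b N hN x
  rw [h, LinearMap.toMatrix_toLin]

/-- The matrix of `g⁻¹` is the inverse matrix. [folklore] -/
private theorem toMatrix_inv' (b : Module.Basis ι K V) (g : V ≃ₗ[K] V) :
    LinearMap.toMatrix b b ((g⁻¹ : V ≃ₗ[K] V) : Module.End K V) =
      (LinearMap.toMatrix b b (g : Module.End K V))⁻¹ := by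
  refine (Matrix.inv_eq_left_inv ?_).symm
  rw [← LinearMap.toMatrix_mul, ← LinearEquiv.coe_toLinearMap_mul, inv_mul_cancel, LinearEquiv.coe_toLinearMap_one,
    LinearMap.toMatrix_id]

/-- Powers of automorphisms, on underlying endomorphisms. [folklore] -/
private theorem coe_toLinearMap_pow'' (e : V ≃ₗ[K] V) (k : ℕ) :
    ((e ^ k : V ≃ₗ[K] V) : Module.End K V) = (e : Module.End K V) ^ k := by
  induction k with
  | zero => rw [pow_zero, pow_zero]; rfl
  | succ k ih => rw [pow_succ, pow_succ, LinearEquiv.coe_toLinearMap_mul, ih]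

/-- An automorphism is determined by its matrix. [folklore] -/
private theorem eq_of_toMatrix_eq (b : Module.Basis ι K V) {g h : V ≃ₗ[K] V}
    (hgh : LinearMap.toMatrix b b (g : Module.End K V) = LinearMap.toMatrix b b (h : Module.End K V)) : g = h :=
  LinearEquiv.toLinearMap_injective ((LinearMap.toMatrix b b).injective hgh)

/-- `LinearEquiv.det g = 1` read on the matrix. [folklore] -/
private theorem det_eq_one_iff_det_toMatrix (b : Module.Basis ι K V) (g : V ≃ₗ[K] V) :
    LinearEquiv.det g = 1 ↔ (LinearMap.toMatrix b b (g : Module.End K V)).det = 1 := by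
  rw [← Units.val_eq_one, LinearEquiv.coe_det, LinearMap.det_toMatrix]

/-- Powers of a transvection in `SL`: `T_{ij}(c)^m = T_{ij}(m c)`. [folklore] -/
private theorem transvection_pow {i j : ι} (hij : i ≠ j) (c : K) (m : ℕ) :
    Matrix.SpecialLinearGroup.transvection hij c ^ m = Matrix.SpecialLinearGroup.transvection hij ((m : K) * c) := by
  induction m with
  | zero => rw [pow_zero, Nat.cast_zero, zero_mul, Matrix.SpecialLinearGroup.transvection_coeff_zero]
  | succ m ih =>
    rw [pow_succ, ih, ← Matrix.SpecialLinearGroup.transvection_add, Nat.cast_succ, add_mul, one_mul]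

/-- Powers of a rank-one torus element in `SL`: `diag(c, c⁻¹)^m = diag(c^m, c^{-m})`, on matrices. [folklore] -/
private theorem coe_diag2n_pow {i j : ι} (hij : i ≠ j) (c : K) (hc : c ≠ 0) (m : ℕ) :
    ((Matrix.SpecialLinearGroup.diag2n hij c hc ^ m : Matrix.SpecialLinearGroup ι K) : Matrix ι ι K) =
      ((Matrix.SpecialLinearGroup.diag2n hij (c ^ m) (pow_ne_zero m hc) : Matrix.SpecialLinearGroup ι K) :
        Matrix ι ι K) := by
  rw [Matrix.SpecialLinearGroup.coe_pow]
  change (Matrix.diagonal fun k => if k = i then c else if k = j then c⁻¹ else 1) ^ m =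
    Matrix.diagonal fun k => if k = i then c ^ m else if k = j then (c ^ m)⁻¹ else 1
  rw [Matrix.diagonal_pow]
  refine congrArg Matrix.diagonal (funext fun k => ?_)
  simp only [Pi.pow_apply]
  split_ifs <;> simp [inv_pow]

/-- The inverse of an invertible diagonal matrix. [folklore] -/
private theorem inv_diagonal_of_ne_zero (d : ι → K) (hd : ∀ k, d k ≠ 0) :
    (Matrix.diagonal d)⁻¹ = Matrix.diagonal fun k => (d k)⁻¹ := by
  refine Matrix.inv_eq_left_inv ?_
  rw [Matrix.diagonal_mul_diagonal]
  convert Matrix.diagonal_one with k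
  exact inv_mul_cancel₀ (hd k)

/-- Conjugating a transvection by a diagonal matrix rescales it:
`diag(d) (1 + a E_{ij}) diag(d)⁻¹ = 1 + (dᵢ a dⱼ⁻¹) E_{ij}`. [folklore] -/
private theorem diagonal_mul_transvection_mul_diagonal_inv {i j : ι} (d : ι → K) (hd : ∀ k, d k ≠ 0) (a : K) :
    Matrix.diagonal d * Matrix.transvection i j a * (Matrix.diagonal d)⁻¹ =
      Matrix.transvection i j (d i * a * (d j)⁻¹) := by
  rw [inv_diagonal_of_ne_zero d hd, Matrix.transvection, Matrix.transvection, Matrix.mul_add, Matrix.add_mul,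
    Matrix.mul_one, Matrix.diagonal_mul_diagonal]
  have h1 : (Matrix.diagonal fun k => d k * (d k)⁻¹) = (1 : Matrix ι ι K) := by
    convert Matrix.diagonal_one with k
    exact mul_inv_cancel₀ (hd k)
  rw [h1]
  congr 1
  ext k l
  simp only [Matrix.mul_diagonal, Matrix.diagonal_mul, Matrix.single_apply]
  by_cases h : i = k ∧ j = l
  · obtain ⟨rfl, rfl⟩ := h
    simp
  · simp [h]

/-- `P_{σ⁻¹} P_σ = 1` for permutation matrices. [folklore] -/
private theorem perm_symm_mul_perm (σ : ι ≃ ι) :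
    (σ.symm.toPEquiv.toMatrix : Matrix ι ι K) * σ.toPEquiv.toMatrix = 1 := by
  rw [← PEquiv.toMatrix_trans, ← Equiv.toPEquiv_trans, Equiv.symm_trans_self, Equiv.toPEquiv_refl,
    PEquiv.toMatrix_refl]

/-- Conjugating a diagonal matrix by the permutation matrix of `σ` permutes the entries:
`P_σ diag(d) P_σ⁻¹ = diag(d ∘ σ)`. [folklore] -/
private theorem perm_mul_diagonal_mul_perm_inv (σ : ι ≃ ι) (d : ι → K) :
    (σ.toPEquiv.toMatrix : Matrix ι ι K) * Matrix.diagonal d * (σ.toPEquiv.toMatrix : Matrix ι ι K)⁻¹ =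
      Matrix.diagonal (d ∘ σ) := by
  rw [Matrix.inv_eq_left_inv (perm_symm_mul_perm σ), PEquiv.toMatrix_toPEquiv_mul, PEquiv.mul_toMatrix_toPEquiv,
    Equiv.symm_symm, Matrix.submatrix_submatrix, Function.comp_id, Function.id_comp, Matrix.submatrix_diagonal_equiv]

/-- The inverse matrix of a transvection. [folklore] -/
private theorem transvection_inv_eq {i j : ι} (hij : i ≠ j) (a : K) :
    (Matrix.transvection i j a)⁻¹ = Matrix.transvection i j (-a) := by
  refine Matrix.inv_eq_left_inv ?_
  rw [Matrix.transvection_mul_transvection_same _ _ hij, neg_add_cancel, Matrix.transvection_zero]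

end Matrices

/-! ### §2 `SL(V) ⊆ Γ^Zar ⇒ SL(V) ⊆ (Γ^Zar)°` -/

section IdentityComponent

variable [Module.Finite K V]

omit [Module.Finite K V] in
/-- In dimension `≤ 1` the only determinant-one automorphism is the identity. [folklore] -/
private theorem eq_one_of_det_eq_one_of_finrank_le_one {n : ℕ} (b : Module.Basis (Fin n) K V) (hn : n ≤ 1)
    {u : V ≃ₗ[K] V} (hu : LinearEquiv.det u = 1) : u = 1 := by
  haveI : Subsingleton (Fin n) := Fin.subsingleton_iff_le_one.mpr hn
  refine eq_of_toMatrix_eq b ?_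
  have hdet := Matrix.det_eq_elem_of_subsingleton (LinearMap.toMatrix b b (u : Module.End K V))
  rw [(det_eq_one_iff_det_toMatrix b u).1 hu] at hdet
  rw [LinearEquiv.coe_toLinearMap_one, LinearMap.toMatrix_id]
  ext i j
  rw [Subsingleton.elim j i, ← hdet i, Matrix.one_apply_eq]

/-- The induction over `SL(ι, K)` behind `mem_glIdentityComponent_of_det_eq_one`: every special-linear
matrix is the matrix of a point of `Λ^Zar(K)`, for `Λ` of finite index in `Γ`. [cite: Borel1991, I.2.2] -/
private theorem exists_mem_glZariskiClosure_toMatrix_eq_of_finiteIndex [IsAlgClosed K] [CharZero K]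
    {ι : Type*} [Fintype ι] [DecidableEq ι] [Nontrivial ι] (b : Module.Basis ι K V) {Γ Λ : Subgroup (V ≃ₗ[K] V)}
    (hSL : ∀ u : V ≃ₗ[K] V, LinearEquiv.det u = 1 → u ∈ glZariskiClosure Γ) (hfi : (Λ.subgroupOf Γ).FiniteIndex)
    (B : Matrix.SpecialLinearGroup ι K) :
    ∃ g ∈ glZariskiClosure Λ, LinearMap.toMatrix b b (g : Module.End K V) = (B : Matrix ι ι K) := by
  set M : ℕ := (Λ.subgroupOf Γ).index.factorial with hMdef
  have hM : 0 < M := Nat.factorial_pos _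
  have hMK : (M : K) ≠ 0 := Nat.cast_ne_zero.2 hM.ne'
  have hpow : ∀ t ∈ glZariskiClosure Γ, t ^ M ∈ glZariskiClosure Λ :=
    fun t ht => pow_factorial_index_mem_glZariskiClosure hfi ht
  refine Matrix.SpecialLinearGroup.diagonal_transvection_induction'
    (fun B => ∃ g ∈ glZariskiClosure Λ, LinearMap.toMatrix b b (g : Module.End K V) = (B : Matrix ι ι K)) B
    ?_ ?_ ?_
  · -- rank-one tori: `diag(c, c⁻¹) = diag(z, z⁻¹)^M` with `z^M = c`
    intro i j hij c hc
    obtain ⟨z, hz⟩ := IsAlgClosed.exists_pow_nat_eq c hM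
    have hz0 : z ≠ 0 := fun h => hc (by rw [← hz, h, zero_pow hM.ne'])
    obtain ⟨t, ht⟩ := exists_linearEquiv_toMatrix_eq b
      ((Matrix.SpecialLinearGroup.diag2n hij z hz0 : Matrix.SpecialLinearGroup ι K) : Matrix ι ι K)
      (by rw [(Matrix.SpecialLinearGroup.diag2n hij z hz0).2]; exact isUnit_one)
    have htΓ : t ∈ glZariskiClosure Γ :=
      hSL t ((det_eq_one_iff_det_toMatrix b t).2 (by rw [ht]; exact (Matrix.SpecialLinearGroup.diag2n hij z hz0).2))
    refine ⟨t ^ M, hpow t htΓ, ?_⟩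
    rw [coe_toLinearMap_pow'', ← LinearMap.toMatrix_pow, ht, ← Matrix.SpecialLinearGroup.coe_pow, coe_diag2n_pow]
    simp_rw [hz]
  · -- transvections: `T(a) = T(a/M)^M`
    intro i j hij a
    obtain ⟨t, ht⟩ := exists_linearEquiv_toMatrix_eq b
      ((Matrix.SpecialLinearGroup.transvection hij (a / M) : Matrix.SpecialLinearGroup ι K) : Matrix ι ι K)
      (by rw [(Matrix.SpecialLinearGroup.transvection hij (a / M)).2]; exact isUnit_one)
    have htΓ : t ∈ glZariskiClosure Γ :=
      hSL t ((det_eq_one_iff_det_toMatrix b t).2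
        (by rw [ht]; exact (Matrix.SpecialLinearGroup.transvection hij (a / M)).2))
    refine ⟨t ^ M, hpow t htΓ, ?_⟩
    rw [coe_toLinearMap_pow'', ← LinearMap.toMatrix_pow, ht, ← Matrix.SpecialLinearGroup.coe_pow,
      transvection_pow, mul_div_cancel₀ a hMK]
  · -- products
    rintro B C ⟨g₁, hg₁, h₁⟩ ⟨g₂, hg₂, h₂⟩
    refine ⟨g₁ * g₂, mul_mem_glZariskiClosure hg₁ hg₂, ?_⟩
    rw [LinearEquiv.coe_toLinearMap_mul, LinearMap.toMatrix_mul, h₁, h₂, Matrix.SpecialLinearGroup.coe_mul]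

/-- **`SL(V)(K) ⊆ Γ^Zar(K) ⇒ SL(V)(K) ⊆ (Γ^Zar)°(K)`** for `K` algebraically closed of characteristic `0`:
"`SL_n` is connected, hence lies in the identity component of any algebraic group containing it" (Borel
I.2.2–2.3), on points. Proof: `SL(V)` is generated by transvections and rank-one tori (Mathlib
`diagonal_transvection_induction'`); a transvection `T(a) = T(a/M)^M` and a torus element
`diag(c, c⁻¹) = diag(z, z⁻¹)^M` (`z^M = c`) are `M`-th powers of determinant-one automorphisms, which lie in
`Γ^Zar(K)` by hypothesis, and `M := [Γ : Λ]!`-th powers of points of `Γ^Zar(K)` lie in `Λ^Zar(K)`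
(`pow_factorial_index_mem_glZariskiClosure`); `Λ^Zar(K)` is a group. [cite: Borel1991, I.2.2] -/
theorem mem_glIdentityComponent_of_det_eq_one [IsAlgClosed K] [CharZero K] {Γ : Subgroup (V ≃ₗ[K] V)}
    (hSL : ∀ u : V ≃ₗ[K] V, LinearEquiv.det u = 1 → u ∈ glZariskiClosure Γ) {u : V ≃ₗ[K] V}
    (hu : LinearEquiv.det u = 1) : u ∈ glIdentityComponent Γ := by
  classical
  let b := Module.finBasis K V
  by_cases hn : Module.finrank K V ≤ 1
  · rw [eq_one_of_det_eq_one_of_finrank_le_one b hn hu]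
    exact one_mem_glIdentityComponent Γ
  haveI : Nontrivial (Fin (Module.finrank K V)) := Fin.nontrivial_iff_two_le.mpr (by omega)
  rw [mem_glIdentityComponent_iff]
  intro Λ _ hfi
  obtain ⟨g, hg, hgu⟩ := exists_mem_glZariskiClosure_toMatrix_eq_of_finiteIndex b hSL hfi
    ⟨LinearMap.toMatrix b b (u : Module.End K V), (det_eq_one_iff_det_toMatrix b u).1 hu⟩
  rwa [← eq_of_toMatrix_eq b (h := u) hgu]

/-- The same with the determinant condition on the underlying linear map. [cite: Borel1991, I.2.2] -/
theorem mem_glIdentityComponent_of_linearMap_det_eq_one [IsAlgClosed K] [CharZero K] {Γ : Subgroup (V ≃ₗ[K] V)}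
    (hSL : ∀ u : V ≃ₗ[K] V, LinearMap.det (u : Module.End K V) = 1 → u ∈ glZariskiClosure Γ)
    {u : V ≃ₗ[K] V} (hu : LinearMap.det (u : Module.End K V) = 1) : u ∈ glIdentityComponent Γ := by
  refine mem_glIdentityComponent_of_det_eq_one (fun w hw => hSL w ?_) ?_
  · rw [← LinearEquiv.coe_det, hw, Units.val_one]
  · rw [← Units.val_eq_one, LinearEquiv.coe_det, hu]

end IdentityComponent

/-! ### §3 Commutators of `GL(V)` in `Γ^Zar` ⇒ `SL(V) ⊆ Γ^Zar` -/

section Commutators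

variable [Module.Finite K V]

/-- The induction over `SL(ι, K)` behind `mem_glZariskiClosure_of_det_eq_one_of_commutators`: every
special-linear matrix is the matrix of a point of `Γ^Zar(K)` when `Γ^Zar(K)` contains all commutators of
`GL(V)`. [cite: Borel1991, I.2.3] -/
private theorem exists_mem_glZariskiClosure_toMatrix_eq_of_commutators [CharZero K]
    {ι : Type*} [Fintype ι] [DecidableEq ι] [Nontrivial ι] (b : Module.Basis ι K V) {Γ : Subgroup (V ≃ₗ[K] V)}
    (hcomm : ∀ g h : V ≃ₗ[K] V, g * h * g⁻¹ * h⁻¹ ∈ glZariskiClosure Γ) (B : Matrix.SpecialLinearGroup ι K) :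
    ∃ g ∈ glZariskiClosure Γ, LinearMap.toMatrix b b (g : Module.End K V) = (B : Matrix ι ι K) := by
  -- commutators, read on matrices
  have hmat : ∀ g h : V ≃ₗ[K] V, ∃ k ∈ glZariskiClosure Γ, LinearMap.toMatrix b b (k : Module.End K V) =
      LinearMap.toMatrix b b (g : Module.End K V) * LinearMap.toMatrix b b (h : Module.End K V) *
        (LinearMap.toMatrix b b (g : Module.End K V))⁻¹ * (LinearMap.toMatrix b b (h : Module.End K V))⁻¹ := by
    intro g h
    refine ⟨g * h * g⁻¹ * h⁻¹, hcomm g h, ?_⟩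
    rw [LinearEquiv.coe_toLinearMap_mul, LinearEquiv.coe_toLinearMap_mul, LinearEquiv.coe_toLinearMap_mul,
      LinearMap.toMatrix_mul, LinearMap.toMatrix_mul, LinearMap.toMatrix_mul, toMatrix_inv', toMatrix_inv']
  refine Matrix.SpecialLinearGroup.diagonal_transvection_induction'
    (fun B => ∃ g ∈ glZariskiClosure Γ, LinearMap.toMatrix b b (g : Module.End K V) = (B : Matrix ι ι K)) B
    ?_ ?_ ?_
  · -- rank-one tori: `diag(cᵢ, cⱼ⁻¹) = [diag(cᵢ), P_{(ij)}]`
    intro i j hij c hc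
    let d : ι → K := fun k => if k = i then c else 1
    have hd : ∀ k, d k ≠ 0 := fun k => by by_cases hk : k = i <;> simp [d, hk, hc]
    have hdet : IsUnit (Matrix.diagonal d).det := by
      rw [Matrix.det_diagonal, isUnit_iff_ne_zero]
      exact Finset.prod_ne_zero_iff.2 fun k _ => hd k
    obtain ⟨g, hg⟩ := exists_linearEquiv_toMatrix_eq b (Matrix.diagonal d) hdet
    obtain ⟨p, hp⟩ := exists_linearEquiv_toMatrix_eq b ((Equiv.swap i j).toPEquiv.toMatrix)
      (Matrix.isUnit_det_of_left_inverse (perm_symm_mul_perm (K := K) (Equiv.swap i j)))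
    obtain ⟨k, hk, hkmat⟩ := hmat g p
    refine ⟨k, hk, ?_⟩
    rw [hkmat, hg, hp, Matrix.mul_assoc (Matrix.diagonal d), Matrix.mul_assoc (Matrix.diagonal d),
      inv_diagonal_of_ne_zero d hd, perm_mul_diagonal_mul_perm_inv, Matrix.diagonal_mul_diagonal]
    change _ = Matrix.diagonal fun k => if k = i then c else if k = j then c⁻¹ else 1
    refine congrArg Matrix.diagonal (funext fun k => ?_)
    simp only [Function.comp_apply, d]
    by_cases hki : k = i
    · subst hki
      simp [Equiv.swap_apply_left, hij.symm]
    · by_cases hkj : k = j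
      · subst hkj
        simp [Equiv.swap_apply_right, hki]
      · simp [hki, hkj, Equiv.swap_apply_of_ne_of_ne hki hkj]
  · -- transvections: `T(a) = [diag(2ᵢ), T(a)]`
    intro i j hij a
    let d : ι → K := fun k => if k = i then 2 else 1
    have hd : ∀ k, d k ≠ 0 := fun k => by by_cases hk : k = i <;> simp [d, hk]
    have hdet : IsUnit (Matrix.diagonal d).det := by
      rw [Matrix.det_diagonal, isUnit_iff_ne_zero]
      exact Finset.prod_ne_zero_iff.2 fun k _ => hd k
    obtain ⟨g, hg⟩ := exists_linearEquiv_toMatrix_eq b (Matrix.diagonal d) hdet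
    obtain ⟨t, ht⟩ := exists_linearEquiv_toMatrix_eq b (Matrix.transvection i j a)
      (by rw [Matrix.det_transvection_of_ne i j hij]; exact isUnit_one)
    obtain ⟨k, hk, hkmat⟩ := hmat g t
    refine ⟨k, hk, ?_⟩
    rw [hkmat, hg, ht, transvection_inv_eq hij, diagonal_mul_transvection_mul_diagonal_inv d hd a,
      Matrix.transvection_mul_transvection_same _ _ hij]
    change Matrix.transvection i j _ = Matrix.transvection i j a
    congr 1
    simp [d, hij.symm]
    ring
  · -- products
    rintro B C ⟨g₁, hg₁, h₁⟩ ⟨g₂, hg₂, h₂⟩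
    refine ⟨g₁ * g₂, mul_mem_glZariskiClosure hg₁ hg₂, ?_⟩
    rw [LinearEquiv.coe_toLinearMap_mul, LinearMap.toMatrix_mul, h₁, h₂, Matrix.SpecialLinearGroup.coe_mul]

/-- **`(GL(V), GL(V)) ⊆ Γ^Zar(K) ⇒ SL(V)(K) ⊆ Γ^Zar(K)`** (`char K = 0`): if the commutator of any two
automorphisms of `V` lies in `Γ^Zar(K)`, so does every determinant-one automorphism — a transvection
`T_{ij}(a)` is the commutator `[diag(…,2ᵢ,…), T_{ij}(a)]`, a rank-one torus element `diag(cᵢ, cⱼ⁻¹)` is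
the commutator `[diag(…,cᵢ,…), P_{(ij)}]` with the transposition matrix, these generate `SL(V)` (Mathlib
`diagonal_transvection_induction'`), and `Γ^Zar(K)` is a group. (Borel I.2.3: `(GL_n, GL_n) = SL_n`.)
[cite: Borel1991, I.2.3] -/
theorem mem_glZariskiClosure_of_det_eq_one_of_commutators [CharZero K] {Γ : Subgroup (V ≃ₗ[K] V)}
    (hcomm : ∀ g h : V ≃ₗ[K] V, g * h * g⁻¹ * h⁻¹ ∈ glZariskiClosure Γ) {u : V ≃ₗ[K] V}
    (hu : LinearEquiv.det u = 1) : u ∈ glZariskiClosure Γ := by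
  classical
  let b := Module.finBasis K V
  by_cases hn : Module.finrank K V ≤ 1
  · rw [eq_one_of_det_eq_one_of_finrank_le_one b hn hu]
    exact one_mem_glZariskiClosure Γ
  haveI : Nontrivial (Fin (Module.finrank K V)) := Fin.nontrivial_iff_two_le.mpr (by omega)
  obtain ⟨g, hg, hgu⟩ := exists_mem_glZariskiClosure_toMatrix_eq_of_commutators b hcomm
    ⟨LinearMap.toMatrix b b (u : Module.End K V), (det_eq_one_iff_det_toMatrix b u).1 hu⟩
  rwa [← eq_of_toMatrix_eq b (h := u) hgu]

/-- **Both together** (`K` algebraically closed of characteristic `0`): if all commutators of `GL(V)(K)` lie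
in `Γ^Zar(K)`, then every determinant-one automorphism lies in the identity component `(Γ^Zar)°(K)`.
[cite: Borel1991, I.2.2 and I.2.3] -/
theorem mem_glIdentityComponent_of_det_eq_one_of_commutators [IsAlgClosed K] [CharZero K]
    {Γ : Subgroup (V ≃ₗ[K] V)} (hcomm : ∀ g h : V ≃ₗ[K] V, g * h * g⁻¹ * h⁻¹ ∈ glZariskiClosure Γ)
    {u : V ≃ₗ[K] V} (hu : LinearEquiv.det u = 1) : u ∈ glIdentityComponent Γ :=
  mem_glIdentityComponent_of_det_eq_one (fun _ hw => mem_glZariskiClosure_of_det_eq_one_of_commutators hcomm hw) hu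

end Commutators

end Literature.AlgebraicGeometry.HodgeTheory

end
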